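import Summits.HubbardSuperconductivity.HubbardSuperconductivity.Theorems.BalabanIRBirBdGPhaseCoercivityLyapunovCore
import Summits.HubbardSuperconductivity.HubbardSuperconductivity.Theorems.BalabanIRBirBdGPhaseCoercivityLyapunovBond

/-!
# Route BalabanIR — crux 3 `BirBdGPhaseCoercivity` (item `stmt-HubbardSuperconductivity-2081`):
# PROOF OF THE CRUX (phase coercivity of the `d+id` Bogoliubov–de Gennes energy, all parameters)

THEOREM (`birBdGPhaseCoercivity_proof`, the item's statement verbatim — stated structurally so
that this closing module does not import the route file, per the route's materialisation rule):
for every `μ ∈ (-4,4)`, `Δ₁ ≠ 0`, `Δ₂ ≠ 0` there are `c₀ > 0` and `L₀` (here `L₀ = 3`) such that on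
every torus `(ℤ/L)²`, `L ≥ L₀`, and for every phase texture `θ`,
  `c₀ Σ_x Σ_{y ∼ x} (1 - cos(θ_x - θ_y)) ≤ Σ_i |λ_i(Hb(0))| - Σ_i |λ_i(Hb(θ))|`.
The constant is `c₀ = m Δ₁² / (2 E_max²)` with `m = min_{[0,2π]²} E > 0` the uniform BdG gap
(`lyap_uniform_gap`: compactness and `bdg_dispersion_pos`) and `E_max² = (4+|μ|)² + (4|Δ₁|+4|Δ₂|)²`.

PROOF = `lyap_core` (file `…LyapunovCore`: the Lyapunov/BCS-duality deficit bound
`S(0) - S(θ) ≥ (m/4) ‖[F, diag e^{iθ}]‖²_HS`, `F` the anomalous amplitude of the reference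
ground state) + `lyap_bond` (file `…LyapunovBond`: `‖[F, diag e^{iθ}]‖²_HS ≥ (2Δ₁²/E_max²) R(θ)`
through the nearest-neighbour pair amplitude `(Δ₁/N) Σ_k (cos p₀ - cos p₁)²/E_k ≥ Δ₁/E_max`).
The underlying inequality `S(C) - S(D) ≥ 2⟨C, 𝓛_E⁻¹ C⟩ - 2⟨D, 𝓛_E⁻¹ D⟩` (`lyap_deficit`) is the
Legendre transform of the BCS functional with the DESIGNED pair interaction `V = 𝓛_E`
(`𝓛_E α = Eα + αE`), for which Bach's stability form vanishes identically; on the lattice its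
right-hand side is the manifestly nonnegative Bergström sum
`½ Σ_{kk'} |Û_{kk'}|² E_k E_{k'} |Δ_k/E_k - Δ_{k'}/E_{k'}|²/(E_k + E_{k'})`, which dominates the
frozen-metric symbol of the file `…Reduction` (arithmetic vs. harmonic mean of `E_k, E_{k'}`) and,
unlike it, is coercive on the whole parameter domain including the band-edge collar.

References: V. Bach, E. H. Lieb, J. P. Solovej, J. Stat. Phys. 76 (1994) 3; A. Deuchert,
A. Geisinger, C. Hainzl, M. Loss, Ann. Henri Poincaré 19 (2018) 1507; C. Hainzl, R. Seiringer,
J. Math. Phys. 57 (2016) 021101. No definition is introduced.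
-/

noncomputable section

namespace Summit.HubbardSuperconductivity.HubbardSuperconductivity.Theorems

namespace BirBdG

open Matrix Finset Literature.Probability.LatticeModels
open scoped ComplexConjugate

/-! ### The uniform gap and the crude upper bound -/

/-- A crude upper bound for `E²`: `ξ² + |Δ|² ≤ (4 + |μ|)² + (4|Δ₁| + 4|Δ₂|)²`. [folklore] -/
theorem lyap_norm_sq_gap_le (μ Δ₁ Δ₂ θ₀ θ₁ : ℝ) :
    (-2 * Real.cos θ₀ - 2 * Real.cos θ₁ - μ) ^ 2 +
        ‖((2 * Δ₁ * (Real.cos θ₀ - Real.cos θ₁) : ℝ) : ℂ) -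
          4 * Complex.I * ((Δ₂ * Real.sin θ₀ * Real.sin θ₁ : ℝ) : ℂ)‖ ^ 2 ≤
      (4 + |μ|) ^ 2 + (4 * |Δ₁| + 4 * |Δ₂|) ^ 2 := by
  -- adapted from `norm_sq_gap_le_crude` (file …PointCertificate, which imports the route file)
  have hc0 := Real.abs_cos_le_one θ₀
  have hc1 := Real.abs_cos_le_one θ₁
  have hs0 := Real.abs_sin_le_one θ₀
  have hs1 := Real.abs_sin_le_one θ₁
  have hξ : |-2 * Real.cos θ₀ - 2 * Real.cos θ₁ - μ| ≤ 4 + |μ| := by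
    calc |-2 * Real.cos θ₀ - 2 * Real.cos θ₁ - μ| ≤ |-2 * Real.cos θ₀ - 2 * Real.cos θ₁| + |μ| := abs_sub _ _
      _ ≤ (|-2 * Real.cos θ₀| + |2 * Real.cos θ₁|) + |μ| := by gcongr; exact abs_sub _ _
      _ ≤ 4 + |μ| := by rw [abs_mul, abs_mul, abs_neg, abs_two]; linarith
  have hΔ : ‖((2 * Δ₁ * (Real.cos θ₀ - Real.cos θ₁) : ℝ) : ℂ) -
      4 * Complex.I * ((Δ₂ * Real.sin θ₀ * Real.sin θ₁ : ℝ) : ℂ)‖ ≤ 4 * |Δ₁| + 4 * |Δ₂| := by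
    refine (norm_sub_le _ _).trans ?_
    have h1 : |Real.cos θ₀ - Real.cos θ₁| ≤ 2 := by
      have := abs_sub (Real.cos θ₀) (Real.cos θ₁); linarith
    have t1 : ‖((2 * Δ₁ * (Real.cos θ₀ - Real.cos θ₁) : ℝ) : ℂ)‖ ≤ 4 * |Δ₁| := by
      rw [Complex.norm_real, Real.norm_eq_abs, abs_mul, abs_mul, abs_two]
      nlinarith [abs_nonneg Δ₁, abs_nonneg (Real.cos θ₀ - Real.cos θ₁)]
    have t2 : ‖4 * Complex.I * ((Δ₂ * Real.sin θ₀ * Real.sin θ₁ : ℝ) : ℂ)‖ ≤ 4 * |Δ₂| := by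
      rw [norm_mul, norm_mul, Complex.norm_I, mul_one, Complex.norm_real, Real.norm_eq_abs, abs_mul, abs_mul,
        show ‖(4 : ℂ)‖ = 4 by norm_num]
      have h2 : |Real.sin θ₀| * |Real.sin θ₁| ≤ 1 := by
        nlinarith [abs_nonneg (Real.sin θ₀), abs_nonneg (Real.sin θ₁)]
      nlinarith [abs_nonneg Δ₂, abs_nonneg (Real.sin θ₀), abs_nonneg (Real.sin θ₁)]
    linarith
  have h1 : (-2 * Real.cos θ₀ - 2 * Real.cos θ₁ - μ) ^ 2 ≤ (4 + |μ|) ^ 2 := by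
    rw [← sq_abs (-2 * Real.cos θ₀ - 2 * Real.cos θ₁ - μ)]
    exact pow_le_pow_left₀ (abs_nonneg _) hξ 2
  have h2 := pow_le_pow_left₀ (norm_nonneg _) hΔ 2
  linarith

/-- **The uniform gap.** For `μ ∈ (-4,4)`, `Δ₁Δ₂ ≠ 0` the BdG dispersion has a positive minimum on
the momentum square `[0,2π]²` (compactness + `bdg_dispersion_pos`). [folklore] -/
theorem lyap_uniform_gap (μ Δ₁ Δ₂ : ℝ) (hμ : μ ∈ Set.Ioo (-4 : ℝ) 4) (h₁ : Δ₁ ≠ 0) (h₂ : Δ₂ ≠ 0) :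
    ∃ m : ℝ, 0 < m ∧ ∀ p₀ p₁ : ℝ, p₀ ∈ Set.Icc 0 (2 * Real.pi) → p₁ ∈ Set.Icc 0 (2 * Real.pi) →
      m ≤ Real.sqrt ((-2 * Real.cos p₀ - 2 * Real.cos p₁ - μ) ^ 2 +
        ‖((2 * Δ₁ * (Real.cos p₀ - Real.cos p₁) : ℝ) : ℂ) -
          4 * Complex.I * ((Δ₂ * Real.sin p₀ * Real.sin p₁ : ℝ) : ℂ)‖ ^ 2) := by
  set g : ℝ × ℝ → ℝ := fun p => (-2 * Real.cos p.1 - 2 * Real.cos p.2 - μ) ^ 2 +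
      ‖((2 * Δ₁ * (Real.cos p.1 - Real.cos p.2) : ℝ) : ℂ) -
        4 * Complex.I * ((Δ₂ * Real.sin p.1 * Real.sin p.2 : ℝ) : ℂ)‖ ^ 2 with hg
  have hgc : Continuous g := by
    rw [hg]
    fun_prop
  have hK : IsCompact (Set.Icc (0 : ℝ) (2 * Real.pi) ×ˢ Set.Icc (0 : ℝ) (2 * Real.pi)) :=
    isCompact_Icc.prod isCompact_Icc
  have hne : (Set.Icc (0 : ℝ) (2 * Real.pi) ×ˢ Set.Icc (0 : ℝ) (2 * Real.pi)).Nonempty :=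
    ⟨(0, 0), ⟨⟨le_rfl, by positivity⟩, ⟨le_rfl, by positivity⟩⟩⟩
  obtain ⟨p, hp, hmin⟩ := hK.exists_isMinOn hne hgc.continuousOn
  have hgp : 0 < g p := by
    rw [hg]
    exact bdg_dispersion_pos μ Δ₁ Δ₂ p.1 p.2 hμ h₁ h₂
  refine ⟨Real.sqrt (g p), Real.sqrt_pos.2 hgp, fun p₀ p₁ hp₀ hp₁ => ?_⟩
  have hle : g p ≤ g (p₀, p₁) := hmin (Set.mk_mem_prod hp₀ hp₁)
  exact Real.sqrt_le_sqrt (by simpa [hg] using hle)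

/-- Lattice momenta lie in `[0, 2π]`. [folklore] -/
theorem lyap_latticeMomentum_mem {L : ℕ} [NeZero L] (k : TorusSite 2 L) (i : Fin 2) :
    latticeMomentum L k i ∈ Set.Icc (0 : ℝ) (2 * Real.pi) := by
  have hL : (0 : ℝ) < L := by exact_mod_cast Nat.pos_of_ne_zero (NeZero.ne L)
  have hv : ((k i).val : ℝ) ≤ L := by exact_mod_cast (ZMod.val_lt (k i)).le
  simp only [latticeMomentum, Set.mem_Icc]
  constructor
  · positivity
  · rw [mul_div_assoc]
    have : ((k i).val : ℝ) / L ≤ 1 := (div_le_one hL).2 hv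
    nlinarith [Real.pi_pos]

/-! ### The crux -/

/-- **Phase coercivity of the `d+id` Bogoliubov–de Gennes energy** (route BalabanIR, crux 3
`BirBdGPhaseCoercivity`, item stmt-HubbardSuperconductivity-2081; the statement is the item's body
verbatim). See the module docstring for the constant and the proof. [cite: BachLiebSolovej1994, Theorem 2.11] -/
theorem birBdGPhaseCoercivity_proof : ∀ (μ Δ₁ Δ₂ : ℝ), μ ∈ Set.Ioo (-4:ℝ) 4 → Δ₁ ≠ 0 → Δ₂ ≠ 0 → ∃ c₀ : ℝ, 0 < c₀ ∧ ∃ L₀ : ℕ, ∀ (L : ℕ) [NeZero L], L₀ ≤ L → let nnx : Literature.Probability.LatticeModels.TorusSite 2 L → Literature.Probability.LatticeModels.TorusSite 2 L → Prop := fun x y => y = x + ![1, 0] ∨ y = x + ![-1, 0]; let nny : Literature.Probability.LatticeModels.TorusSite 2 L → Literature.Probability.LatticeModels.TorusSite 2 L → Prop := fun x y => y = x + ![0, 1] ∨ y = x + ![0, -1]; let dg1 : Literature.Probability.LatticeModels.TorusSite 2 L → Literature.Probability.LatticeModels.TorusSite 2 L → Prop := fun x y => y = x + ![1, 1] ∨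 y = x + ![-1, -1]; let dg2 : Literature.Probability.LatticeModels.TorusSite 2 L → Literature.Probability.LatticeModels.TorusSite 2 L → Prop := fun x y => y = x + ![1, -1] ∨ y = x + ![-1, 1]; let h : Matrix (Literature.Probability.LatticeModels.TorusSite 2 L) (Literature.Probability.LatticeModels.TorusSite 2 L) ℂ := fun x y => -(if nnx x y ∨ nny x y then (1 : ℂ) else 0) - (if x = y then (μ : ℂ) else 0); let D : (Literature.Probability.LatticeModels.TorusSite 2 L → ℝ) → Matrix (Literature.Probability.LatticeModels.TorusSite 2 L) (Literature.Probability.LatticeModels.TorusSite 2 L) ℂ := fun θ x y => ((Δ₁ : ℂ) * ((if nnx x y then (1 : ℂ) else 0) - (if nny x y then (1 : ℂ) else 0)) + Complex.I * (Δ₂ : ℂ) * ((if dg1 x y then (1 : ℂ) else 0) - (if dg2 x y then (1 : ℂ) else 0))) * (Complex.exp (Complex.I * (θ x : ℂ)) + Complex.exp (Complex.I * (θ y : ℂ))) / 2; let Hb : (Literature.Probability.LatticeModels.TorusSite 2 L → ℝ) → Matrix (Literature.Probability.LatticeModels.TorusSite 2 L ⊕ Literature.Probability.LatticeModels.TorusSite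 2 L) (Literature.Probability.LatticeModels.TorusSite 2 L ⊕ Literature.Probability.LatticeModels.TorusSite 2 L) ℂ := fun θ => Matrix.fromBlocks h (D θ) (Matrix.conjTranspose (D θ)) (-h); ∀ θ : Literature.Probability.LatticeModels.TorusSite 2 L → ℝ, ∀ (hθ : (Hb θ).IsHermitian) (h0 : (Hb (fun _ => 0)).IsHermitian), c₀ * ∑ x : Literature.Probability.LatticeModels.TorusSite 2 L, ∑ y : Literature.Probability.LatticeModels.TorusSite 2 L, (if nnx x y ∨ nny x y then (1 - Real.cos (θ x - θ y)) else 0) ≤ ∑ i, |h0.eigenvalues i| - ∑ i, |hθ.eigenvalues i| := by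
  intro μ Δ₁ Δ₂ hμ h₁ h₂
  obtain ⟨m, hm, hmle⟩ := lyap_uniform_gap μ Δ₁ Δ₂ hμ h₁ h₂
  set Emax : ℝ := Real.sqrt ((4 + |μ|) ^ 2 + (4 * |Δ₁| + 4 * |Δ₂|) ^ 2) with hEmax
  have hEmaxpos : 0 < Emax := by
    rw [hEmax]
    exact Real.sqrt_pos.2 (by positivity)
  have hΔ₁sq : 0 < Δ₁ ^ 2 := by positivity
  refine ⟨m / 4 * (2 * Δ₁ ^ 2 / Emax ^ 2), by positivity, 3, ?_⟩
  intro L _ hL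
  -- the symbols at side `L`
  set ξ : TorusSite 2 L → ℝ := fun k =>
    -2 * Real.cos (latticeMomentum L k 0) - 2 * Real.cos (latticeMomentum L k 1) - μ with hξ
  set Δ : TorusSite 2 L → ℂ := fun k =>
    ((2 * Δ₁ * (Real.cos (latticeMomentum L k 0) - Real.cos (latticeMomentum L k 1)) : ℝ) : ℂ) -
      4 * Complex.I * ((Δ₂ * Real.sin (latticeMomentum L k 0) * Real.sin (latticeMomentum L k 1) : ℝ) : ℂ)
    with hΔ
  set E : TorusSite 2 L → ℝ := fun k => Real.sqrt (ξ k ^ 2 + ‖Δ k‖ ^ 2) with hE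
  have hmE : ∀ k, m ≤ E k := fun k =>
    hmle _ _ (lyap_latticeMomentum_mem k 0) (lyap_latticeMomentum_mem k 1)
  have hEpos : ∀ k, 0 < E k := fun k => lt_of_lt_of_le hm (hmE k)
  have hEmaxle : ∀ k, E k ≤ Emax := fun k =>
    Real.sqrt_le_sqrt (lyap_norm_sq_gap_le μ Δ₁ Δ₂ _ _)
  have core := lyap_core μ Δ₁ Δ₂ m hL ξ E Δ (fun _ => rfl) (fun _ => rfl) (fun _ => rfl) hm hmE
  intro nnx nny dg1 dg2 h D Hb θ hθ h0
  have hb := lyap_bond μ Δ₁ Δ₂ Emax hL ξ E Δ (fun _ => rfl) (fun _ => rfl) (fun _ => rfl) hEpos hEmaxle θ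
  have hc := core θ hθ h0
  calc m / 4 * (2 * Δ₁ ^ 2 / Emax ^ 2) * ∑ x : TorusSite 2 L, ∑ y : TorusSite 2 L,
        (if nnx x y ∨ nny x y then (1 - Real.cos (θ x - θ y)) else 0)
      = m / 4 * (2 * Δ₁ ^ 2 / Emax ^ 2 * ∑ x : TorusSite 2 L, ∑ y : TorusSite 2 L,
        (if nnx x y ∨ nny x y then (1 - Real.cos (θ x - θ y)) else 0)) := by ring
    _ ≤ m / 4 * ∑ x : TorusSite 2 L, ∑ y : TorusSite 2 L,
        ‖(((L ^ 2 : ℕ) : ℂ)⁻¹ • ((Matrix.of fun k x : TorusSite 2 L => conj (torusChar k x))ᴴ *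
            Matrix.diagonal (fun k => Δ k / (E k : ℂ)) *
            Matrix.of (fun k x : TorusSite 2 L => conj (torusChar k x)))) x y‖ ^ 2 *
          ‖Complex.exp (Complex.I * (θ y : ℂ)) - Complex.exp (Complex.I * (θ x : ℂ))‖ ^ 2 :=
        mul_le_mul_of_nonneg_left hb (by positivity)
    _ ≤ ∑ i, |h0.eigenvalues i| - ∑ i, |hθ.eigenvalues i| := hc

end BirBdG

end Summit.HubbardSuperconductivity.HubbardSuperconductivity.Theorems

end
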